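import Mathlib
import Summits.Ventures.HodgeRepro2.T5GaussianField
import Summits.Ventures.HodgeRepro2.T5GaussianPlace
import Summits.Ventures.HodgeRepro2.T5ConcretePlaces
import Summits.Ventures.HodgeRepro2.T6N5LocalRamToyEps
import Summits.Ventures.HodgeRepro2.T6N5LocalRamWitness

/-!
# T6N5LocalGaussianWitness — Tier 6, M2 sub-step N5 (t6-p8's half): THE COMPLETION-LEVEL WITNESS ON A CONCRETE
PLACE — `ℚ(ζ₄)/ℚ` at `2` (p4's `T5GaussianPlace`): `ℚ₂ ⊆ ℚ₂(i)`, wildly ramified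

The README §10.5(ii)(c),(d) witness of the ramified statement of record v2 (`N5Local_main_ram_completion_weil''`)
on a concrete pair of number fields and places inside Mathlib: `K = ℚ`, `L = ℚ(ζ₄) = CyclotomicField 4 ℚ`
(p4's `T5GaussianField`), `v = v₂` the place of `ℚ` above `2`, `w` any place of `L` above it (one exists,
`T5ConcretePlaces.wild`); p4's `T5GaussianPlace.hypotheses_satisfiable` supplies the ramified place data
(`[L_w : K_v] = 2`, the uniformisers, ramification, `σ ≠ 1`), bundled as `gaussianPlace w : RamPlace v₂ w`, and
`T6N5LocalRamWitness` does the rest: `gaussian_witness` — the datum's `ψ_δ` exists and the coupled local system of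
Theorem N5.T2 is solved on `ℚ₂(i)^× ⊇ ℚ₂^×` with every hypothesis of the statement of record v2 instantiated.
README §8(d): uses an L-value-free non-vanishing device: NO.
-/

namespace Summit.Ventures.HodgeRepro2.T6.N5LocalGaussianWitness

open Summit.Ventures.HodgeRepro2 IsDedekindDomain HeightOneSpectrum
  Summit.Ventures.HodgeRepro2.T6.N5LocalDatum Summit.Ventures.HodgeRepro2.T6.N5Local
  Summit.Ventures.HodgeRepro2.T6.N5LocalTateChars Summit.Ventures.HodgeRepro2.T6.N5LocalRamToyEps
  Summit.Ventures.HodgeRepro2.T6.N5LocalRamWitness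

noncomputable section

/-- A place of `ℚ(ζ₄)` above `2` exists (p4's `T5ConcretePlaces.wild`). -/
theorem exists_place_above_two :
    ∃ w : HeightOneSpectrum (NumberField.RingOfIntegers T5GaussianField.L),
      w.asIdeal.LiesOver T5GaussianField.v₂.asIdeal :=
  T5ConcretePlaces.wild.1

variable (w : HeightOneSpectrum (NumberField.RingOfIntegers T5GaussianField.L))
  [w.asIdeal.LiesOver T5GaussianField.v₂.asIdeal]

/-- The ramified place data of `ℚ₂ ⊆ ℚ₂(i)` (p4's `T5GaussianPlace.hypotheses_satisfiable`), bundled. -/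
def gaussianPlace : RamPlace T5GaussianField.v₂ w :=
  let h := T5GaussianPlace.hypotheses_satisfiable w
  { h2 := h.1
    ϖ := Classical.choose h.2
    hϖ := (Classical.choose_spec (Classical.choose_spec h.2)).1
    π := Classical.choose (Classical.choose_spec h.2)
    hπ := (Classical.choose_spec (Classical.choose_spec h.2)).2.1
    hram := (Classical.choose_spec (Classical.choose_spec h.2)).2.2.1
    σ := Classical.choose (Classical.choose_spec (Classical.choose_spec h.2)).2.2.2
    hσ := Classical.choose_spec (Classical.choose_spec (Classical.choose_spec h.2)).2.2.2 }

/-- THE WITNESS ON `ℚ₂ ⊆ ℚ₂(i)`: the datum's `ψ_δ` exists and the coupled local system of Theorem N5.T2 is solved,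
with every hypothesis of the statement of record v2 instantiated on the genuine carriers. -/
theorem gaussian_witness :
    ∃ ψδ : PsiC w, (∀ a : T5GaussianField.v₂.adicCompletion ℚ,
      ψδ.1 (algebraMap (T5GaussianField.v₂.adicCompletion ℚ) (w.adicCompletion T5GaussianField.L) a) = 1) ∧
      ∃ ξ : Fin 4 → (w.adicCompletion T5GaussianField.L)ˣ →* ℂˣ,
        LocalSolution (XT (gaussianPlace w) ψδ).toWeil.toLocalSignDatum ξ :=
  exists_psi_localSolution_ram (gaussianPlace w)

end

end Summit.Ventures.HodgeRepro2.T6.N5LocalGaussianWitness
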